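import Summits.AtomisticToContinuum.Crystallization.Theorems.ReggeStarCoercivityDefectFreeCrystallizesGoodGrowth
import Summits.AtomisticToContinuum.Crystallization.Theorems.ReggeStarCoercivityDefectFreeCrystallizesLinkExact
import Summits.AtomisticToContinuum.Crystallization.Theorems.ReggeStarCoercivityDefectFreeCrystallizesChartTransfer
import Summits.AtomisticToContinuum.Crystallization.Theorems.ReggeStarCoercivityDefectFreeCrystallizesDevelopment
import Summits.AtomisticToContinuum.Crystallization.Theorems.PalmUnimodularRigidityShellsToBarlowChart

/-!
# THE FUNNEL CHART AT TOLERANCE `1/20` (R1 `stub_funnelChart` of line `palm-good-law`, crux stmt-AtomisticToContinuum-13603)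

**Theorem (`stub_funnelChart`).**  A non-empty set `S ⊆ ℝ³` ALL of whose points are `SetGood` (the crux's `1/20`-predicate
read on an infinite configuration: the other points of `S` in the open `6/5`-ball, recentred and rescaled by some `a ∈ [9/10, 11/10]`,
are `1/20`-matched after a linear isometry to the FCC or the HCP kissing pattern) is globally bond-isomorphic to an ideal Barlow
stacking: there are a Hägg sequence `s` and a bijection `Φ : barlowStacking 1 √(2/3) s → S` with ideal contacts `↔` pairs at
distance in `(0, 6/5)`.  This is crux 9227 `ShellsToBarlowChart` (tolerance `a/100`, `a ≤ 1`, closed `5a/4`-ball) at tolerance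
`1/20` — potential-free geometry, the structural half of route β of the line.

**Proof** = the composition `funnelChart_of` of the lead-c4 skeleton (v15) over its five registered stubs, ALL LANDED:
R1a1 `GoodCharts.stub_goodCharts` (p127141, integer charts at `a/20`), R1a2 `LinkExact.stub_linkExact` (p128533, label contact ⇒
bond: four-slot argument below scale `12/11`, `45°` exclusion above), R1a3 `ChartTransfer.stub_chartTransfer` (p127791 + p128033,
two-shell rigidity at `1/20` by link types and the scale-product inequality), R1a4 `Development.stub_combinatorialDevelopment`
(p128955 … p133002, 9227's transport development ported to abstract charts, 25 files) and R1b `GoodGrowth.stub_goodGrowth`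
(p133273, connectivity and cubic growth).  Charts with exact links and transfer on `S` are carried to the rescaled set
`S' = (19/20) • S` (the crux's bond relation `0 < d < 6/5` on `S` is EXACTLY 9227's bond window `0 < d' ≤ 28/25` on `S'` by radial
pinning, `GoodGrowth.bond_smul_iff`), the development gives a `TransportSystem` on `S'`, 9227's growth descent
(`barlowChart_of_transportSystem`: `stub_developCovering`, `stub_deckTransitive`, `stub_powerTranslation`, `stub_quotientGrowth` BY
NAME, with an existential cubic constant) a bond-faithful bijection `Ψ` onto `S'`, and `Φ := (20/19) • Ψ` is the funnel chart.
-/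

noncomputable section

namespace Summit.AtomisticToContinuum.Crystallization.Theorems.PalmGoodLaw.FunnelChart

open Literature.MathematicalPhysics.StatisticalMechanics Literature.Geometry.DiscreteGeometry
open Summit.AtomisticToContinuum.Crystallization.Theorems.PalmGoodLaw (SetGood)
open Summit.AtomisticToContinuum.Crystallization.Theorems.PalmGoodLaw.GoodGrowth (bond_smul_iff smul_back)
open Summit.AtomisticToContinuum.Crystallization.Theorems.PalmUnimodularRigidityShellsToBarlowChart
  (fcc3Int IsBond bondNbrs contacts windowGraph windowBall IsBondCovering IsContactAut TransportSystem
   stub_developCovering stub_deckTransitive stub_powerTranslation stub_quotientGrowth)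
open scoped Pointwise

/-- Redoing the rescaling. [folklore] -/
theorem smul_forth (x : (EuclideanSpace ℝ (Fin 3))) : (19 / 20 : ℝ) • ((20 / 19 : ℝ) • x) = x := by
  rw [smul_smul]; norm_num

/-- Membership in the rescaled set. [folklore] -/
theorem mem_smulSet_iff {S : Set (EuclideanSpace ℝ (Fin 3))} {x' : (EuclideanSpace ℝ (Fin 3))} : x' ∈ (19 / 20 : ℝ) • S ↔ (20 / 19 : ℝ) • x' ∈ S := by
  constructor
  · rintro ⟨x, hx, rfl⟩
    simpa only [smul_back] using hx
  · intro h
    exact ⟨_, h, smul_forth x'⟩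

/-- **9227's growth descent, with an existential cubic constant** (the logic of `barlowChart_of_stubs`, stubs 3–5 BY NAME): a
transport system on `S'` plus eventual cubic growth of the window-graph balls give a bond-faithful bijection from an ideal Barlow
stacking onto `S'` (bond window `(0, 28/25]`).  Develop (`stub_developCovering`); a coincidence `Ψ p = Ψ p'`, `p ≠ p'`, yields a
site-free deck automorphism (`stub_deckTransitive`) moving every site by graph distance `≥ 3`, a power of which is a non-zero
period `τ` over `Ψ` (`stub_powerTranslation`); then balls grow at most quadratically (`stub_quotientGrowth`) — against `C·n³`. -/
theorem barlowChart_of_transportSystem {S' : Set (EuclideanSpace ℝ (Fin 3))} (hT : TransportSystem S')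
    (hgrowth : ∀ x ∈ S', ∃ C : ℝ, 0 < C ∧ ∃ n₀ : ℕ, ∀ n : ℕ, n₀ ≤ n →
      C * (n : ℝ) ^ 3 ≤ (Set.ncard (windowBall S' x n) : ℝ)) :
    ∃ s : ℤ → ℤ, IsHaggSeq s ∧ ∃ Ψ : (EuclideanSpace ℝ (Fin 3)) → (EuclideanSpace ℝ (Fin 3)), Set.BijOn Ψ (barlowStacking 1 (Real.sqrt (2 / 3)) s) S' ∧
      ∀ p ∈ barlowStacking 1 (Real.sqrt (2 / 3)) s, ∀ q ∈ barlowStacking 1 (Real.sqrt (2 / 3)) s,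
        (dist p q = 1 ↔ IsBond (Ψ p) (Ψ q)) := by
  obtain ⟨s, hs, Ψ, hcov⟩ := stub_developCovering S' hT
  obtain ⟨hmaps, hsurj, hstar, hlink⟩ := hcov
  -- Step 1: `Ψ` is injective on the model (the growth descent).
  have hinj : Set.InjOn Ψ (barlowStacking 1 (Real.sqrt (2 / 3)) s) := by
    intro p hp p' hp' hpp'
    by_contra hne'
    obtain ⟨σ, ⟨hbij, hcontact⟩, hdeck, -, hfree⟩ :=
      stub_deckTransitive S' s Ψ hs ⟨hmaps, hsurj, hstar, hlink⟩ p hp p' hp' hpp' hne'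
    have hd1 : ∀ q ∈ barlowStacking 1 (Real.sqrt (2 / 3)) s, dist q (σ q) ≠ 1 := by
      intro q hq h1
      have hσq : σ q ∈ contacts s q := ⟨hbij.mapsTo hq, h1⟩
      have hb : Ψ (σ q) ∈ bondNbrs S' (Ψ q) := (hstar q hq).mapsTo hσq
      have hpos : 0 < dist (Ψ q) (Ψ (σ q)) := hb.2.1
      rw [hdeck q hq, dist_self] at hpos
      exact lt_irrefl _ hpos
    have hd2 : ∀ q ∈ barlowStacking 1 (Real.sqrt (2 / 3)) s, ∀ m ∈ barlowStacking 1 (Real.sqrt (2 / 3)) s,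
        dist q m = 1 → dist m (σ q) ≠ 1 := by
      intro q hq m hm hqm h2
      have hq' : q ∈ contacts s m := ⟨hq, by rw [dist_comm]; exact hqm⟩
      have hσq : σ q ∈ contacts s m := ⟨hbij.mapsTo hq, h2⟩
      exact hfree q hq ((hstar m hm).injOn hσq hq' (hdeck q hq))
    obtain ⟨τ, hτ, hper, n₁, hiter⟩ := stub_powerTranslation s σ hs ⟨hbij, hcontact⟩ hfree hd1 hd2
    have hiterB : ∀ k : ℕ, ∀ q ∈ barlowStacking 1 (Real.sqrt (2 / 3)) s,
        σ^[k] q ∈ barlowStacking 1 (Real.sqrt (2 / 3)) s ∧ Ψ (σ^[k] q) = Ψ q := by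
      intro k
      induction k with
      | zero => intro q hq; exact ⟨hq, rfl⟩
      | succ k ih =>
        intro q hq
        obtain ⟨hkq, hΨk⟩ := ih q hq
        refine ⟨?_, ?_⟩
        · rw [Function.iterate_succ_apply']
          exact hbij.mapsTo hkq
        · rw [Function.iterate_succ_apply', hdeck _ hkq, hΨk]
    have hΨτ : ∀ q ∈ barlowStacking 1 (Real.sqrt (2 / 3)) s, Ψ (q + τ) = Ψ q := by
      intro q hq
      rw [← hiter q hq]
      exact (hiterB n₁ q hq).2
    have hstarsurj : ∀ p ∈ barlowStacking 1 (Real.sqrt (2 / 3)) s, bondNbrs S' (Ψ p) ⊆ Ψ '' contacts s p :=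
      fun p hp => (hstar p hp).surjOn
    obtain ⟨K, hK⟩ := stub_quotientGrowth S' s Ψ τ hs hstarsurj hτ hper hΨτ p hp
    obtain ⟨C, hC, n₀, hCn⟩ := hgrowth (Ψ p) (hmaps hp)
    -- choose a radius beating both bounds
    obtain ⟨n, hn⟩ := exists_nat_gt (max (n₀ : ℝ) (max 1 (4 * K / C + 1)))
    have hn0 : (n₀ : ℝ) < n := lt_of_le_of_lt (le_max_left _ _) hn
    have hn0' : n₀ ≤ n := by exact_mod_cast hn0.le
    have hn1 : (1 : ℝ) < n := lt_of_le_of_lt ((le_max_left _ _).trans (le_max_right _ _)) hn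
    have hnK : 4 * K / C + 1 < n := lt_of_le_of_lt ((le_max_right _ _).trans (le_max_right _ _)) hn
    have hlow := hCn n hn0'
    have hup := hK n
    have hle : C * (n : ℝ) ^ 3 ≤ K * ((n : ℝ) + 1) ^ 2 := hlow.trans hup
    set N : ℝ := (n : ℝ) with hN
    rcases le_or_gt K 0 with hK0 | hK0
    · have h1 : K * (N + 1) ^ 2 ≤ 0 := mul_nonpos_of_nonpos_of_nonneg hK0 (sq_nonneg _)
      have h2 : (0 : ℝ) < C * N ^ 3 := by positivity
      linarith
    · have h1 : K * (N + 1) ^ 2 ≤ K * (4 * N ^ 2) :=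
        mul_le_mul_of_nonneg_left (by nlinarith) hK0.le
      have h2 : C * N ^ 3 ≤ 4 * K * N ^ 2 := by linarith
      have hN2 : (0 : ℝ) < N ^ 2 := by positivity
      have h3 : C * N ≤ 4 * K := by
        have : C * N * N ^ 2 ≤ 4 * K * N ^ 2 := by nlinarith
        exact le_of_mul_le_mul_right this hN2
      have h4 : N ≤ 4 * K / C := by
        rw [le_div_iff₀ hC]; linarith
      linarith
  -- Step 2: bijection and bond-faithfulness.
  refine ⟨s, hs, Ψ, ⟨hmaps, hinj, hsurj⟩, fun p hp q hq => ⟨fun hpq => ?_, fun hb => ?_⟩⟩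
  · have hq' : q ∈ contacts s p := ⟨hq, hpq⟩
    exact ((hstar p hp).mapsTo hq').2
  · have hy : Ψ q ∈ bondNbrs S' (Ψ p) := ⟨hmaps hq, hb⟩
    obtain ⟨q', hq', hqq'⟩ := (hstar p hp).surjOn hy
    have hqeq : q' = q := hinj hq'.1 hq hqq'
    rw [← hqeq]
    exact hq'.2

/-- **R1 from its five stubs (no sorry): `stub_goodCharts → stub_linkExact → stub_chartTransfer →
stub_combinatorialDevelopment → stub_goodGrowth → FunnelChart`.**  Charts with exact links and transfer on `S` are carried to the
rescaled set `S' = (19/20) • S` (patterns and labels transported, bonds identified by `bond_smul_iff`), the combinatorial development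
gives a transport system on `S'`, the descent `barlowChart_of_transportSystem` a bond-faithful bijection `Ψ` onto `S'`, and
`Φ := (20/19) • Ψ` is the funnel chart of `S`. -/
theorem funnelChart_of
    (h₁ : ∀ S : Set (EuclideanSpace ℝ (Fin 3)), (∀ x ∈ S, SetGood S x) →
      ∃ (ac : EuclideanSpace ℝ (Fin 3) → ℝ) (Pc : EuclideanSpace ℝ (Fin 3) → Finset (Fin 3 → ℤ))
        (Ac : EuclideanSpace ℝ (Fin 3) → (EuclideanSpace ℝ (Fin 3) →ₗᵢ[ℝ] EuclideanSpace ℝ (Fin 3)))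
        (nb : EuclideanSpace ℝ (Fin 3) → (Fin 3 → ℤ) → EuclideanSpace ℝ (Fin 3)),
        ∀ x ∈ S, (Pc x = fcc3Int ∨ Pc x = hcpInt) ∧ 9 / 10 ≤ ac x ∧ ac x ≤ 11 / 10 ∧
          Set.BijOn (nb x) (↑(Pc x) : Set (Fin 3 → ℤ))
            {y | y ∈ S ∧ (0 < dist x y ∧ dist x y < 6 / 5)} ∧
          (∀ t ∈ Pc x, dist (nb x t) (x + (ac x * (Real.sqrt 18)⁻¹) • Ac x (intVec t)) ≤ ac x / 20) ∧
          (∀ t ∈ Pc x, ∀ t' ∈ Pc x,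
            (0 < dist (nb x t) (nb x t') ∧ dist (nb x t) (nb x t') < 6 / 5) → sqNormInt (t - t') = 18))
    (h₂ : ∀ S : Set (EuclideanSpace ℝ (Fin 3)), (∀ x ∈ S, SetGood S x) →
      ∀ x ∈ S, ∀ (a : ℝ) (P : Finset (Fin 3 → ℤ))
        (A : EuclideanSpace ℝ (Fin 3) →ₗᵢ[ℝ] EuclideanSpace ℝ (Fin 3)) (nbr : (Fin 3 → ℤ) → EuclideanSpace ℝ (Fin 3)),
        (P = fcc3Int ∨ P = hcpInt) → 9 / 10 ≤ a → a ≤ 11 / 10 →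
        Set.BijOn nbr (↑P : Set (Fin 3 → ℤ)) {y | y ∈ S ∧ (0 < dist x y ∧ dist x y < 6 / 5)} →
        (∀ t ∈ P, dist (nbr t) (x + (a * (Real.sqrt 18)⁻¹) • A (intVec t)) ≤ a / 20) →
        ∀ t ∈ P, ∀ t' ∈ P, sqNormInt (t - t') = 18 →
          (0 < dist (nbr t) (nbr t') ∧ dist (nbr t) (nbr t') < 6 / 5))
    (h₃ : ∀ S : Set (EuclideanSpace ℝ (Fin 3)), (∀ x ∈ S, SetGood S x) →
      ∀ (ac : EuclideanSpace ℝ (Fin 3) → ℝ) (Pc : EuclideanSpace ℝ (Fin 3) → Finset (Fin 3 → ℤ))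
        (Ac : EuclideanSpace ℝ (Fin 3) → (EuclideanSpace ℝ (Fin 3) →ₗᵢ[ℝ] EuclideanSpace ℝ (Fin 3)))
        (nb : EuclideanSpace ℝ (Fin 3) → (Fin 3 → ℤ) → EuclideanSpace ℝ (Fin 3)),
        (∀ x ∈ S, (Pc x = fcc3Int ∨ Pc x = hcpInt) ∧ 9 / 10 ≤ ac x ∧ ac x ≤ 11 / 10 ∧
          Set.BijOn (nb x) (↑(Pc x) : Set (Fin 3 → ℤ))
            {y | y ∈ S ∧ (0 < dist x y ∧ dist x y < 6 / 5)} ∧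
          (∀ t ∈ Pc x, dist (nb x t) (x + (ac x * (Real.sqrt 18)⁻¹) • Ac x (intVec t)) ≤ ac x / 20) ∧
          (∀ t ∈ Pc x, ∀ t' ∈ Pc x,
            ((0 < dist (nb x t) (nb x t') ∧ dist (nb x t) (nb x t') < 6 / 5) ↔ sqNormInt (t - t') = 18))) →
        ∀ x ∈ S, ∀ y ∈ S, (0 < dist x y ∧ dist x y < 6 / 5) →
          ∀ (z z' : EuclideanSpace ℝ (Fin 3)) (t t' u u' : Fin 3 → ℤ),
            ((t = 0 ∧ z = x) ∨ (t ∈ Pc x ∧ z = nb x t)) → ((t' = 0 ∧ z' = x) ∨ (t' ∈ Pc x ∧ z' = nb x t')) →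
            ((u = 0 ∧ z = y) ∨ (u ∈ Pc y ∧ z = nb y u)) → ((u' = 0 ∧ z' = y) ∨ (u' ∈ Pc y ∧ z' = nb y u')) →
            sqNormInt (u - u') = sqNormInt (t - t'))
    (h₄ : ∀ S' : Set (EuclideanSpace ℝ (Fin 3)), S'.Nonempty →
      (∀ x ∈ S', ∀ y ∈ S', Nonempty ((windowGraph S').Walk x y)) →
      ∀ (Pc : EuclideanSpace ℝ (Fin 3) → Finset (Fin 3 → ℤ))
        (nb : EuclideanSpace ℝ (Fin 3) → (Fin 3 → ℤ) → EuclideanSpace ℝ (Fin 3)),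
        (∀ x ∈ S', Pc x = fcc3Int ∨ Pc x = hcpInt) →
        (∀ x ∈ S', Set.BijOn (nb x) (↑(Pc x) : Set (Fin 3 → ℤ))
          {y | y ∈ S' ∧ (0 < dist x y ∧ dist x y ≤ 28 / 25)}) →
        (∀ x ∈ S', ∀ t ∈ Pc x, ∀ t' ∈ Pc x,
          ((0 < dist (nb x t) (nb x t') ∧ dist (nb x t) (nb x t') ≤ 28 / 25) ↔ sqNormInt (t - t') = 18)) →
        (∀ x ∈ S', ∀ y ∈ S', (0 < dist x y ∧ dist x y ≤ 28 / 25) →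
          ∀ (z z' : EuclideanSpace ℝ (Fin 3)) (t t' u u' : Fin 3 → ℤ),
            ((t = 0 ∧ z = x) ∨ (t ∈ Pc x ∧ z = nb x t)) → ((t' = 0 ∧ z' = x) ∨ (t' ∈ Pc x ∧ z' = nb x t')) →
            ((u = 0 ∧ z = y) ∨ (u ∈ Pc y ∧ z = nb y u)) → ((u' = 0 ∧ z' = y) ∨ (u' ∈ Pc y ∧ z' = nb y u')) →
            sqNormInt (u - u') = sqNormInt (t - t')) →
        TransportSystem S')
    (h₅ : ∀ S : Set (EuclideanSpace ℝ (Fin 3)), (∀ x ∈ S, SetGood S x) →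
      (∀ x ∈ S, ∀ y ∈ S, Nonempty ((windowGraph ((19 / 20 : ℝ) • S)).Walk ((19 / 20 : ℝ) • x) ((19 / 20 : ℝ) • y))) ∧
      (∀ x ∈ S, ∃ C : ℝ, 0 < C ∧ ∃ n₀ : ℕ, ∀ n : ℕ, n₀ ≤ n →
        C * (n : ℝ) ^ 3 ≤ (Set.ncard (windowBall ((19 / 20 : ℝ) • S) ((19 / 20 : ℝ) • x) n) : ℝ))) :
    ∀ S : Set (EuclideanSpace ℝ (Fin 3)), S.Nonempty → (∀ x ∈ S, SetGood S x) →
      ∃ s : ℤ → ℤ, IsHaggSeq s ∧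
        ∃ Φ : EuclideanSpace ℝ (Fin 3) → EuclideanSpace ℝ (Fin 3),
          Set.BijOn Φ (barlowStacking 1 (Real.sqrt (2 / 3)) s) S ∧
          ∀ p ∈ barlowStacking 1 (Real.sqrt (2 / 3)) s, ∀ q ∈ barlowStacking 1 (Real.sqrt (2 / 3)) s,
            (dist p q = 1 ↔ (0 < dist (Φ p) (Φ q) ∧ dist (Φ p) (Φ q) < 6 / 5)) := by
  intro S hne hS
  -- charts on `S`, with exact links
  obtain ⟨ac, Pc, Ac, nb, hch⟩ := h₁ S hS
  have hlink : ∀ x ∈ S, ∀ t ∈ Pc x, ∀ t' ∈ Pc x,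
      ((0 < dist (nb x t) (nb x t') ∧ dist (nb x t) (nb x t') < 6 / 5) ↔ sqNormInt (t - t') = 18) := by
    intro x hx t ht t' ht'
    obtain ⟨hP, ha9, ha11, hbij, hclose, hlk⟩ := hch x hx
    exact ⟨hlk t ht t' ht', h₂ S hS x hx (ac x) (Pc x) (Ac x) (nb x) hP ha9 ha11 hbij hclose t ht t' ht'⟩
  have hch' : ∀ x ∈ S, (Pc x = fcc3Int ∨ Pc x = hcpInt) ∧ 9 / 10 ≤ ac x ∧ ac x ≤ 11 / 10 ∧
      Set.BijOn (nb x) (↑(Pc x) : Set (Fin 3 → ℤ)) {y | y ∈ S ∧ (0 < dist x y ∧ dist x y < 6 / 5)} ∧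
      (∀ t ∈ Pc x, dist (nb x t) (x + (ac x * (Real.sqrt 18)⁻¹) • Ac x (intVec t)) ≤ ac x / 20) ∧
      (∀ t ∈ Pc x, ∀ t' ∈ Pc x,
        ((0 < dist (nb x t) (nb x t') ∧ dist (nb x t) (nb x t') < 6 / 5) ↔ sqNormInt (t - t') = 18)) := by
    intro x hx
    obtain ⟨hP, ha9, ha11, hbij, hclose, -⟩ := hch x hx
    exact ⟨hP, ha9, ha11, hbij, hclose, hlink x hx⟩
  have htr := h₃ S hS ac Pc Ac nb hch'
  -- the rescaled set and its chart data
  set S' : Set (EuclideanSpace ℝ (Fin 3)) := (19 / 20 : ℝ) • S with hS'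
  have hmem : ∀ {x : (EuclideanSpace ℝ (Fin 3))}, x ∈ S → (19 / 20 : ℝ) • x ∈ S' := fun hx => Set.smul_mem_smul_set hx
  have hmem' : ∀ {x' : (EuclideanSpace ℝ (Fin 3))}, x' ∈ S' → (20 / 19 : ℝ) • x' ∈ S := fun hx' => mem_smulSet_iff.1 hx'
  let Pc' : (EuclideanSpace ℝ (Fin 3)) → Finset (Fin 3 → ℤ) := fun x' => Pc ((20 / 19 : ℝ) • x')
  let nb' : (EuclideanSpace ℝ (Fin 3)) → (Fin 3 → ℤ) → (EuclideanSpace ℝ (Fin 3)) := fun x' t => (19 / 20 : ℝ) • nb ((20 / 19 : ℝ) • x') t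
  have hnbS : ∀ {x : (EuclideanSpace ℝ (Fin 3))}, x ∈ S → ∀ {t : Fin 3 → ℤ}, t ∈ Pc x → nb x t ∈ S :=
    fun hx t ht => ((hch' _ hx).2.2.2.1.mapsTo ht).1
  -- (H1) patterns
  have H1 : ∀ x' ∈ S', Pc' x' = fcc3Int ∨ Pc' x' = hcpInt := fun x' hx' => (hch' _ (hmem' hx')).1
  -- (H2) labels are bijective onto the bonded neighbours of `S'`
  have H2 : ∀ x' ∈ S', Set.BijOn (nb' x') (↑(Pc' x') : Set (Fin 3 → ℤ))
      {y | y ∈ S' ∧ (0 < dist x' y ∧ dist x' y ≤ 28 / 25)} := by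
    intro x' hx'
    have hx := hmem' hx'
    obtain ⟨-, -, -, hbij, -, -⟩ := hch' _ hx
    refine ⟨fun t ht => ?_, fun t ht t' ht' htt' => ?_, fun y' hy' => ?_⟩
    · obtain ⟨hyS, hb⟩ := hbij.mapsTo ht
      refine ⟨hmem hyS, ?_⟩
      have := (bond_smul_iff hS hx hyS).2 hb
      simpa only [nb', smul_forth] using this
    · have h : nb ((20 / 19 : ℝ) • x') t = nb ((20 / 19 : ℝ) • x') t' := by
        have := congrArg (fun v : (EuclideanSpace ℝ (Fin 3)) => (20 / 19 : ℝ) • v) htt'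
        simpa only [nb', smul_back] using this
      exact hbij.injOn ht ht' h
    · obtain ⟨hy'S, hb⟩ := hy'
      have hy := hmem' hy'S
      have hb' : 0 < dist ((20 / 19 : ℝ) • x') ((20 / 19 : ℝ) • y') ∧
          dist ((20 / 19 : ℝ) • x') ((20 / 19 : ℝ) • y') < 6 / 5 := by
        rw [← bond_smul_iff hS hx hy, smul_forth, smul_forth]; exact hb
      obtain ⟨t, ht, hty⟩ := hbij.surjOn ⟨hy, hb'⟩
      refine ⟨t, ht, ?_⟩
      show (19 / 20 : ℝ) • nb ((20 / 19 : ℝ) • x') t = y'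
      rw [hty, smul_forth]
  -- (H3) exact links
  have H3 : ∀ x' ∈ S', ∀ t ∈ Pc' x', ∀ t' ∈ Pc' x',
      ((0 < dist (nb' x' t) (nb' x' t') ∧ dist (nb' x' t) (nb' x' t') ≤ 28 / 25) ↔ sqNormInt (t - t') = 18) := by
    intro x' hx' t ht t' ht'
    have hx := hmem' hx'
    rw [← hlink _ hx t ht t' ht']
    exact bond_smul_iff hS (hnbS hx ht) (hnbS hx ht')
  -- (H4) transfer
  have H4 : ∀ x' ∈ S', ∀ y' ∈ S', (0 < dist x' y' ∧ dist x' y' ≤ 28 / 25) →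
      ∀ (z z' : (EuclideanSpace ℝ (Fin 3))) (t t' u u' : Fin 3 → ℤ),
        ((t = 0 ∧ z = x') ∨ (t ∈ Pc' x' ∧ z = nb' x' t)) → ((t' = 0 ∧ z' = x') ∨ (t' ∈ Pc' x' ∧ z' = nb' x' t')) →
        ((u = 0 ∧ z = y') ∨ (u ∈ Pc' y' ∧ z = nb' y' u)) → ((u' = 0 ∧ z' = y') ∨ (u' ∈ Pc' y' ∧ z' = nb' y' u')) →
        sqNormInt (u - u') = sqNormInt (t - t') := by
    intro x' hx' y' hy' hb z z' t t' u u' hzx hz'x hzy hz'y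
    have hx := hmem' hx'
    have hy := hmem' hy'
    have hb' : 0 < dist ((20 / 19 : ℝ) • x') ((20 / 19 : ℝ) • y') ∧
        dist ((20 / 19 : ℝ) • x') ((20 / 19 : ℝ) • y') < 6 / 5 := by
      rw [← bond_smul_iff hS hx hy, smul_forth, smul_forth]; exact hb
    -- pull the four alternatives back to `S`
    have pull : ∀ {w w₀ : (EuclideanSpace ℝ (Fin 3))} {r : Fin 3 → ℤ},
        ((r = 0 ∧ w = w₀) ∨ (r ∈ Pc' w₀ ∧ w = nb' w₀ r)) →
        ((r = 0 ∧ (20 / 19 : ℝ) • w = (20 / 19 : ℝ) • w₀) ∨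
          (r ∈ Pc ((20 / 19 : ℝ) • w₀) ∧ (20 / 19 : ℝ) • w = nb ((20 / 19 : ℝ) • w₀) r)) := by
      intro w w₀ r h
      rcases h with ⟨hr, hw⟩ | ⟨hr, hw⟩
      · exact Or.inl ⟨hr, by rw [hw]⟩
      · refine Or.inr ⟨hr, ?_⟩
        rw [hw]
        exact smul_back _
    exact htr _ hx _ hy hb' ((20 / 19 : ℝ) • z) ((20 / 19 : ℝ) • z') t t' u u'
      (pull hzx) (pull hz'x) (pull hzy) (pull hz'y)
  -- connectivity and growth of `S'`, the transport system, the descent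
  obtain ⟨hconn, hgrowth⟩ := h₅ S hS
  obtain ⟨x₀, hx₀⟩ := hne
  have hne' : S'.Nonempty := ⟨_, hmem hx₀⟩
  have hconn' : ∀ x' ∈ S', ∀ y' ∈ S', Nonempty ((windowGraph S').Walk x' y') := by
    intro x' hx' y' hy'
    have := hconn _ (hmem' hx') _ (hmem' hy')
    simpa only [smul_forth] using this
  have hgrowth' : ∀ x' ∈ S', ∃ C : ℝ, 0 < C ∧ ∃ n₀ : ℕ, ∀ n : ℕ, n₀ ≤ n →
      C * (n : ℝ) ^ 3 ≤ (Set.ncard (windowBall S' x' n) : ℝ) := by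
    intro x' hx'
    have := hgrowth _ (hmem' hx')
    simpa only [smul_forth] using this
  have hT : TransportSystem S' := h₄ S' hne' hconn' Pc' nb' H1 H2 H3 H4
  obtain ⟨s, hs, Ψ, hΨ, hfaith⟩ := barlowChart_of_transportSystem hT hgrowth'
  -- undo the rescaling
  refine ⟨s, hs, fun p => (20 / 19 : ℝ) • Ψ p, ⟨fun p hp => hmem' (hΨ.mapsTo hp), fun p hp q hq hpq => ?_,
    fun y hy => ?_⟩, fun p hp q hq => ?_⟩
  · have : Ψ p = Ψ q := by
      have := congrArg (fun v : (EuclideanSpace ℝ (Fin 3)) => (19 / 20 : ℝ) • v) hpq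
      simpa only [smul_forth] using this
    exact hΨ.injOn hp hq this
  · obtain ⟨p, hp, hpy⟩ := hΨ.surjOn (hmem hy)
    exact ⟨p, hp, by simp only [hpy, smul_back]⟩
  · rw [hfaith p hp q hq]
    have hu := hmem' (hΨ.mapsTo hp)
    have hv := hmem' (hΨ.mapsTo hq)
    rw [← bond_smul_iff hS hu hv, smul_forth, smul_forth]
    rfl

/-- **R1 `stub_funnelChart` — THE FUNNEL CHART AT TOLERANCE `1/20`** (registered stub of stmt-AtomisticToContinuum-13603, line
`palm-good-law`; v13/v14 stub, split by lead c4 into R1a1–R1b, all landed, reassembled here): a non-empty set `S ⊆ ℝ³` all of whose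
points are `SetGood` is globally bond-isomorphic to an ideal Barlow stacking — a Hägg sequence `s` and a bijection
`Φ : barlowStacking 1 √(2/3) s → S` with ideal contacts `↔` pairs at distance in `(0, 6/5)`. -/
theorem stub_funnelChart :
    ∀ S : Set (EuclideanSpace ℝ (Fin 3)), S.Nonempty → (∀ x ∈ S, SetGood S x) →
      ∃ s : ℤ → ℤ, IsHaggSeq s ∧
        ∃ Φ : EuclideanSpace ℝ (Fin 3) → EuclideanSpace ℝ (Fin 3),
          Set.BijOn Φ (barlowStacking 1 (Real.sqrt (2 / 3)) s) S ∧
          ∀ p ∈ barlowStacking 1 (Real.sqrt (2 / 3)) s, ∀ q ∈ barlowStacking 1 (Real.sqrt (2 / 3)) s,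
            (dist p q = 1 ↔ (0 < dist (Φ p) (Φ q) ∧ dist (Φ p) (Φ q) < 6 / 5)) :=
  funnelChart_of GoodCharts.stub_goodCharts LinkExact.stub_linkExact ChartTransfer.stub_chartTransfer
    Development.stub_combinatorialDevelopment GoodGrowth.stub_goodGrowth

end Summit.AtomisticToContinuum.Crystallization.Theorems.PalmGoodLaw.FunnelChart

end
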